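import Mathlib
import Summits.QuantumFields.YangMills.Theorems.BalabanUVNodesN15BlockMean
import Literature.Probability.LatticeModels.RegularScales
import HarnessLib

/-!
# Route «BalabanUVNodes» (cluster K4 «SpineRates»), Track-A DAG node N15 = spine estimate NE2, BACKGROUND LAYER — FIRST MISSING
# ESTIMATE, part 12b: COEFFICIENT SPECIES S2 — DIFFERENTIATED coefficients (the divergence term `(D^{η*}_U A)(x)` of (3.52)):
# `|∇′a′(x′) − ∇(blockMean a′)(⌊x′∕M⌋)| ≤ (d+1)(M−1)·θ₂` from a (3.36)-SHAPED per-bond letter on the FINE DERIVATIVE located on the two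
# blocks the coarse stencil touches; forward and adjoint quotients; rate `(d+1)·η·G₂` = (coefficient bound) × ONE rate factor `η∕ℓ`

Cell `pub-ymgap`, seat `pub-ymgap-dag-n15-b` (generation g2; FIRST-MISSING-ESTIMATE, HUMAN RULING D-0062; chair R424 venue; ROSTER-D0062
l.26).  `bears_on: R4∕N15`.  Filed `--supports stmt-QuantumFields-19351`.  Base file: 12a `BalabanUVNodesN15BlockMean` (block mean, WINDOW
IDENTITY `fdiffN_blockMean`, `blockMean_lineAvg_eq_avg`); path lemma `LatticeModels.RegularScales.abs_sub_le_mul_l1Dist_of_steps` BY NAME.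

WHY.  In [Balaban1985BackgroundPropagators] (3.52) p. 400 (verbatim, first-hand): *«(V′₁(A)λ)(x) = Σ_{b∈st(x)} i[A′(b), (D^η_U λ)(b)]
+ i[(D^{η*}_U A)(x), λ(x)] + Σ_{b∈st(x)} F′_{1,k}(i ad_{A′(b)}) λ(b₊)»* the middle (zeroth-order) term has the coefficient `(D^{η*}_U A)(x)` — a
lattice DERIVATIVE of the field.  Under the η-pairing its fine version is a difference quotient at spacing `η′`, its coarse version one at
spacing `η = Mη′` of the (linearised) averaged field; the window identity of 12a says the latter is a WINDOW MEAN of the former, so the fit is an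
oscillation of the fine derivative over a window of two blocks — small by ONE MORE DIFFERENCE of regularity than the coefficient's size uses.
This is the clause of the record `t4/T4-EST-U1a.md` §3 STEP 2 (verbatim) *«Where second differences are needed … (3.36) supplies one more
order»*, LOCATED: species S2 is where (3.36) enters NE2-LOCAL-A.  THE PRINT USED (SHAPES only): (3.35)∕(3.36) p. 396 *«|∇^ηA| <
O(1)Mα₀(L^jη)^{−2}»*, *«|∂^{η*}∂^ηA| < O(1)Mα₀(L^jη)^{−3} on □»*; nothing of [B9] asserted.

CONTENTS (all [folklore]: integer arithmetic of blocks, the tree's `ℓ¹` path lemma, finite means).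
* §1 `slab M y₀ μ` (the fine sites of `block(y₀) ∪ block(y₀ + e_μ)`, as a set); `coord_bounds_of_blockMap`, `ediv_eq_of_bounds`,
  `ediv_mem_of_bounds_two`; WINDOW GEOMETRY: `l1Dist_window_le` (a point of the stencil's base segment and a window point are at `ℓ¹` distance
  `≤ d(M−1) + (M−1)`), `mem_slab_of_inHull` (their coordinate hull lies in the slab).
* §2 `abs_sub_windowMean_le` (generic): unit differences `≤ θ₂` on the bonds STARTING in the slab ⟹ `|g′(p) − windowMean g′| ≤ (d+1)(M−1)θ₂`.
* §3 SPECIES S2: `fit_fdiffN_blockMean` (forward quotient `∇^η_μ`, letter located at `⌊x′∕M⌋`), `bdiffN_eq_neg_fdiffN_pred`,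
  `fit_bdiffN_blockMean` (adjoint quotient `∇^{η*}_μ` = the divergence's summand, letter located at `⌊x′∕M⌋ − e_μ`) — both in the `hfit` shape
  `|c′(x′) − c(⌊x′∕M⌋)| ≤ o(⌊x′∕M⌋)` (plug: 12a `hfit_of_pointwise`); `species2_rate` (`θ₂ = η′G₂`, `Mη′ = η` ⟹ `≤ (d+1)·η·G₂`,
  `T4EtaRateCoeffDefect.coeff_osc_rate` BY NAME); `rate_reading_deriv_coeff` (`G₂ = Cℓ^{−3}` ⟹ `(d+1)·(Cℓ^{−2})·(η∕ℓ)`: the coefficient's own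
  (3.35) bound × ONE rate factor, `γ = 1` — (R1) of the record).

HONEST FRAMING ∕ LIMITS.  MECHANISM over hypothesis-SHAPED letters; real scalar fields, flat differences, linearised transport, `ℤ^d`; the
letter sits on bonds STARTING in the two-block slab (one bond beyond the slab along each direction: the tree's path lemma is located at start
points), i.e. on a region of `O(M)` fine sites inside the print's cube `□` of `O(1)M` coarse blocks; no instance against [B6]∕[B9]'s
expansions.  NE2⁺ NOT PRINTED, NOT proved; count-neutral (typed 28∕28; nothing discharged); one finite T⁴ at fixed ε — NOT infinite volume,
NOT OS on ℝ⁴, NOT a mass gap, NOT Clay.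
-/

noncomputable section

namespace Summit.QuantumFields.YangMills.BalabanUVNodes.N15.CoefficientSpecies

open Literature.MathematicalPhysics.QuantumFieldTheory.Balaban1983to89
open Literature.MathematicalPhysics.QuantumFieldTheory.Balaban1983to89.T4EtaRateCoeffDefect (coeff_osc_rate)
open Literature.MathematicalPhysics.QuantumLattice (blockMap blockBase blockSites)
open Literature.Probability.LatticeModels (Site abs_sub_le_mul_l1Dist_of_steps)
open Summit.QuantumFields.YangMills.BalabanUVNodes.N15.DerivDefect (fdiff fdiffN bdiffN fdiff_apply fdiffN_apply bdiffN_apply)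

variable {d : ℕ}

/-! ## §1–§3 Species S2: differentiated coefficients (the divergence term of (3.52)) -/

section Species2

/-- The two-block SLAB of fine sites the coarse stencil `{y₀, y₀ + e_μ}` touches, as a set. [folklore] -/
def slab (M : ℕ) (y₀ : Site d) (μ : Fin d) : Set (Site d) :=
  {z | blockMap M z = y₀ ∨ blockMap M z = y₀ + Pi.single μ 1}

/-- Coordinates of a fine site in terms of its block: `M·⌊x∕M⌋_i ≤ x_i ≤ M·⌊x∕M⌋_i + (M − 1)`. [folklore] -/
theorem coord_bounds_of_blockMap {M : ℕ} (hM : 0 < M) (x : Site d) (i : Fin d) :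
    (M : ℤ) * blockMap M x i ≤ x i ∧ x i ≤ (M : ℤ) * blockMap M x i + ((M : ℤ) - 1) := by
  have hMz : (0 : ℤ) < M := by exact_mod_cast hM
  have h1 := Int.mul_ediv_add_emod (x i) (M : ℤ)
  have h2 := Int.emod_nonneg (x i) hMz.ne'
  have h3 := Int.emod_lt_of_pos (x i) hMz
  show (M : ℤ) * (x i / (M : ℤ)) ≤ x i ∧ x i ≤ (M : ℤ) * (x i / (M : ℤ)) + ((M : ℤ) - 1)
  constructor <;> omega

/-- Floor division from two-sided bounds: `M·c ≤ s ≤ M·c + (M−1) ⟹ s∕M = c`. [folklore] -/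
theorem ediv_eq_of_bounds {M : ℕ} (hM : 0 < M) {s c : ℤ} (h1 : (M : ℤ) * c ≤ s) (h2 : s ≤ (M : ℤ) * c + ((M : ℤ) - 1)) :
    s / (M : ℤ) = c := by
  have hMz : (0 : ℤ) < M := by exact_mod_cast hM
  have hlo : c ≤ s / (M : ℤ) := (Int.le_ediv_iff_mul_le hMz).2 (by linarith)
  have hhi : s / (M : ℤ) < c + 1 := (Int.ediv_lt_iff_lt_mul hMz).2 (by linarith)
  omega

/-- Floor division from two-sided bounds over TWO periods: `M·c ≤ s ≤ M·c + (2M−1) ⟹ s∕M ∈ {c, c+1}`. [folklore] -/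
theorem ediv_mem_of_bounds_two {M : ℕ} (hM : 0 < M) {s c : ℤ} (h1 : (M : ℤ) * c ≤ s)
    (h2 : s ≤ (M : ℤ) * c + (2 * (M : ℤ) - 1)) : s / (M : ℤ) = c ∨ s / (M : ℤ) = c + 1 := by
  have hMz : (0 : ℤ) < M := by exact_mod_cast hM
  have hlo : c ≤ s / (M : ℤ) := (Int.le_ediv_iff_mul_le hMz).2 (by linarith)
  have hhi : s / (M : ℤ) < c + 2 := (Int.ediv_lt_iff_lt_mul hMz).2 (by linarith)
  omega

/-- WINDOW GEOMETRY, the `ℓ¹` count.  A point `p` whose coordinates `i ≠ μ` lie in the segment of the block `y₀` and whose `μ`-coordinate lies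
in a segment of length `M` offset by `c ∈ [0, M−1]` from the block's base, and a window point `M·y₀ + t + k e_μ` (`t ∈ {0..M−1}^d`, `k < M`),
are at `ℓ¹` distance `≤ d(M−1) + (M−1)`. [folklore] -/
theorem l1Dist_window_le {M : ℕ} (hM : 0 < M) (μ : Fin d) (y₀ : Site d) {p : Site d} {c : ℤ} (hc0 : 0 ≤ c)
    (hcM : c ≤ (M : ℤ) - 1)
    (hp : ∀ i, (M : ℤ) * y₀ i + (if i = μ then c else 0) ≤ p i ∧
      p i ≤ (M : ℤ) * y₀ i + (if i = μ then c else 0) + ((M : ℤ) - 1))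
    {t : Fin d → ℕ} (ht : t ∈ offs d M) {k : ℕ} (hk : k < M) :
    Literature.Probability.LatticeModels.Site.l1Dist p (bpt M y₀ t + Pi.single μ (k : ℤ)) ≤ d * (M - 1) + (M - 1) := by
  unfold Literature.Probability.LatticeModels.Site.l1Dist
  have hti : ∀ i, t i < M := mem_offs.1 ht
  have hbound : ∀ i, (p i - ((bpt M y₀ t + Pi.single μ (k : ℤ) : Site d) i)).natAbs ≤
      (M - 1) + (if i = μ then (M - 1) else 0) := by
    intro i
    have hpi := hp i
    have htiM := hti i
    simp only [Pi.add_apply, bpt_apply]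
    by_cases hi : i = μ
    · subst hi
      simp only [Pi.single_eq_same, if_true] at hpi ⊢
      omega
    · simp only [Pi.single_eq_of_ne hi, if_neg hi, add_zero] at hpi ⊢
      omega
  calc ∑ i, (p i - ((bpt M y₀ t + Pi.single μ (k : ℤ) : Site d) i)).natAbs
      ≤ ∑ i : Fin d, ((M - 1) + (if i = μ then (M - 1) else 0)) := Finset.sum_le_sum fun i _ => hbound i
    _ = d * (M - 1) + (M - 1) := by
        rw [Finset.sum_add_distrib, Finset.sum_const, Finset.card_univ, Fintype.card_fin, smul_eq_mul,
          Finset.sum_ite_eq' Finset.univ μ, if_pos (Finset.mem_univ μ)]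

/-- WINDOW GEOMETRY, the hull.  With `p` and the window point as in `l1Dist_window_le`, every point of their coordinate hull lies in the slab
`block(y₀) ∪ block(y₀ + e_μ)`. [folklore] -/
theorem mem_slab_of_inHull {M : ℕ} (hM : 0 < M) (μ : Fin d) (y₀ : Site d) {p : Site d} {c : ℤ} (hc0 : 0 ≤ c)
    (hcM : c ≤ (M : ℤ) - 1)
    (hp : ∀ i, (M : ℤ) * y₀ i + (if i = μ then c else 0) ≤ p i ∧
      p i ≤ (M : ℤ) * y₀ i + (if i = μ then c else 0) + ((M : ℤ) - 1))
    {t : Fin d → ℕ} (ht : t ∈ offs d M) {k : ℕ} (hk : k < M) {z : Site d}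
    (hz : Literature.Probability.LatticeModels.Site.InHull p (bpt M y₀ t + Pi.single μ (k : ℤ)) z) : z ∈ slab M y₀ μ := by
  have hti : ∀ i, t i < M := mem_offs.1 ht
  -- coordinates `i ≠ μ`: in the block's segment; coordinate `μ`: within two periods
  have hcoord : ∀ i, (M : ℤ) * y₀ i ≤ z i ∧ z i ≤ (M : ℤ) * y₀ i + (if i = μ then (2 * (M : ℤ) - 1) else ((M : ℤ) - 1)) := by
    intro i
    obtain ⟨hz1, hz2⟩ := hz i
    have hpi := hp i
    have htiM := hti i
    simp only [Pi.add_apply, bpt_apply] at hz1 hz2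
    by_cases hi : i = μ
    · subst hi
      simp only [Pi.single_eq_same, if_true] at hpi hz1 hz2 ⊢
      constructor
      · exact le_trans (le_min (by omega) (by omega)) hz1
      · exact le_trans hz2 (max_le (by omega) (by omega))
    · simp only [Pi.single_eq_of_ne hi, if_neg hi, add_zero] at hpi hz1 hz2 ⊢
      constructor
      · exact le_trans (le_min (by omega) (by omega)) hz1
      · exact le_trans hz2 (max_le (by omega) (by omega))
  have hoff : ∀ i, i ≠ μ → z i / (M : ℤ) = y₀ i := fun i hi => by
    have h := hcoord i
    rw [if_neg hi] at h
    exact ediv_eq_of_bounds hM h.1 h.2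
  have hμ : z μ / (M : ℤ) = y₀ μ ∨ z μ / (M : ℤ) = y₀ μ + 1 := by
    have h := hcoord μ
    rw [if_pos rfl] at h
    exact ediv_mem_of_bounds_two hM h.1 h.2
  rcases hμ with h0 | h1
  · left
    funext i
    show z i / (M : ℤ) = y₀ i
    by_cases hi : i = μ
    · subst hi; exact h0
    · exact hoff i hi
  · right
    funext i
    by_cases hi : i = μ
    · subst hi
      show z i / (M : ℤ) = (y₀ + Pi.single i (1 : ℤ) : Site d) i
      rw [Pi.add_apply, Pi.single_eq_same]
      exact h1
    · show z i / (M : ℤ) = (y₀ + Pi.single μ (1 : ℤ) : Site d) i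
      rw [Pi.add_apply, Pi.single_eq_of_ne hi, add_zero]
      exact hoff i hi

/-- THE WINDOW FIT (generic): if the unit differences of a fine function `g′` are `≤ θ₂` on every bond STARTING in the slab
`block(y₀) ∪ block(y₀ + e_μ)` (`θ₂ ≥ 0`), then at every point `p` as in `l1Dist_window_le` the function is within `(d+1)(M−1)·θ₂` of the
WINDOW MEAN `blockMean (lineAvg_μ g′) y₀` (path lemma `LatticeModels.abs_sub_le_mul_l1Dist_of_steps` BY NAME). [folklore] -/
theorem abs_sub_windowMean_le {M : ℕ} (hM : 0 < M) (μ : Fin d) (y₀ : Site d) {g' : Site d → ℝ} {θ₂ : ℝ}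
    (hstep : ∀ z ∈ slab M y₀ μ, ∀ ν : Fin d, |g' (z + Pi.single ν 1) - g' z| ≤ θ₂)
    {p : Site d} {c : ℤ} (hc0 : 0 ≤ c) (hcM : c ≤ (M : ℤ) - 1)
    (hp : ∀ i, (M : ℤ) * y₀ i + (if i = μ then c else 0) ≤ p i ∧
      p i ≤ (M : ℤ) * y₀ i + (if i = μ then c else 0) + ((M : ℤ) - 1)) :
    |g' p - blockMean M (lineAvg M μ g') y₀| ≤ ((d : ℝ) + 1) * ((M : ℝ) - 1) * θ₂ := by
  have hθ₂ : 0 ≤ θ₂ := by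
    -- the base corner of the block is in the slab
    have hmem : bpt M y₀ (fun _ => 0) ∈ slab M y₀ μ := by
      show blockMap M (bpt M y₀ fun _ => 0) = y₀ ∨ _
      exact Or.inl (blockMap_bpt M y₀ (mem_offs.2 fun _ => hM))
    exact (abs_nonneg _).trans (hstep _ hmem μ)
  rw [blockMean_lineAvg_eq_avg]
  have hS : (offs d M ×ˢ Finset.range M).Nonempty := (offs_nonempty hM).product ⟨0, Finset.mem_range.2 hM⟩
  have key : ∀ w ∈ offs d M ×ˢ Finset.range M,
      |g' p - g' (bpt M y₀ w.1 + Pi.single μ (w.2 : ℤ))| ≤ ((d : ℝ) + 1) * ((M : ℝ) - 1) * θ₂ := by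
    intro w hw
    obtain ⟨ht, hk⟩ := Finset.mem_product.1 hw
    have hk' : w.2 < M := Finset.mem_range.1 hk
    set W : Site d := bpt M y₀ w.1 + Pi.single μ (w.2 : ℤ) with hW
    have hhull : ∀ z, Literature.Probability.LatticeModels.Site.InHull p W z → z ∈ slab M y₀ μ :=
      fun z hz => mem_slab_of_inHull hM μ y₀ hc0 hcM hp ht hk' hz
    -- (`n` generalised: a `rfl` on the closed `ℕ`-valued distance term is expensive to elaborate)
    obtain ⟨n, hn⟩ : ∃ n : ℕ, Literature.Probability.LatticeModels.Site.l1Dist p W = n := ⟨_, rfl⟩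
    have hpath := abs_sub_le_mul_l1Dist_of_steps (T := slab M y₀ μ) hstep n p W hn hhull
    refine hpath.trans ?_
    have hnle : (n : ℝ) ≤ ((d : ℝ) + 1) * ((M : ℝ) - 1) := by
      have h := l1Dist_window_le hM μ y₀ hc0 hcM hp ht hk'
      rw [← hW, hn] at h
      have hcast : ((d * (M - 1) + (M - 1) : ℕ) : ℝ) = ((d : ℝ) + 1) * ((M : ℝ) - 1) := by
        rw [Nat.cast_add, Nat.cast_mul, Nat.cast_sub (by omega : 1 ≤ M)]
        push_cast
        ring
      rw [← hcast]
      exact_mod_cast h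
    calc θ₂ * (n : ℝ) ≤ θ₂ * (((d : ℝ) + 1) * ((M : ℝ) - 1)) := mul_le_mul_of_nonneg_left hnle hθ₂
      _ = ((d : ℝ) + 1) * ((M : ℝ) - 1) * θ₂ := by ring
  exact abs_sub_avg_le hS _ key

/-- SPECIES S2, FORWARD QUOTIENT.  Fine coefficient `∇^{η′}_μ a′`, coarse coefficient `∇^η_μ (blockMean a′)` (`Mη′ = η`); letter: the unit
differences of the FINE DERIVATIVE `∇^{η′}_μ a′` are `≤ θ₂(y)` on the bonds starting in `block(y) ∪ block(y + e_μ)` ((3.36)-SHAPED: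
`θ₂ = η′·sup|∂∂A′|`).  Then `|∇^{η′}_μ a′(x′) − ∇^η_μ(blockMean a′)(⌊x′∕M⌋)| ≤ (d+1)(M−1)·θ₂(⌊x′∕M⌋)` — the `hfit` shape. [folklore] -/
theorem fit_fdiffN_blockMean {M : ℕ} (hM : 0 < M) (μ : Fin d) {η η' : ℝ} (hMη : (M : ℝ) * η' = η) {a' : Site d → ℝ}
    {θ₂ : Site d → ℝ}
    (hstep : ∀ y, ∀ z ∈ slab M y μ, ∀ ν : Fin d,
      |fdiffN η' (fun w => w + Pi.single μ 1) a' (z + Pi.single ν 1) - fdiffN η' (fun w => w + Pi.single μ 1) a' z| ≤ θ₂ y)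
    (x' : Site d) :
    |fdiffN η' (fun w => w + Pi.single μ 1) a' x' - fdiffN η (fun w => w + Pi.single μ 1) (blockMean M a') (blockMap M x')|
      ≤ ((d : ℝ) + 1) * ((M : ℝ) - 1) * θ₂ (blockMap M x') := by
  rw [fdiffN_blockMean hMη]
  have hMz1 : (0 : ℤ) ≤ (M : ℤ) - 1 := by
    have h1 : (1 : ℤ) ≤ M := by exact_mod_cast hM
    linarith
  refine abs_sub_windowMean_le hM μ (blockMap M x') (hstep (blockMap M x')) le_rfl hMz1 fun i => ?_
  simp only [ite_self, add_zero]
  exact coord_bounds_of_blockMap hM x' i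

/-- The adjoint quotient is minus the forward quotient at the predecessor: `∇^{η*}_μ g(x) = −∇^η_μ g(x − e_μ)`. [folklore] -/
theorem bdiffN_eq_neg_fdiffN_pred (η : ℝ) (μ : Fin d) (g : Site d → ℝ) (x : Site d) :
    bdiffN η (Equiv.addRight (Pi.single μ (1 : ℤ))) g x =
      -fdiffN η (fun w => w + Pi.single μ 1) g (x - Pi.single μ 1) := by
  simp only [bdiffN_apply, fdiffN_apply, Equiv.addRight_symm, Equiv.coe_addRight, sub_add_cancel, ← sub_eq_add_neg]
  ring

/-- SPECIES S2, ADJOINT QUOTIENT (the divergence's summand `∇^{η*}_μ A_μ` of (3.52)).  Same letter, located on the bonds starting in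
`block(⌊x′∕M⌋ − e_μ) ∪ block(⌊x′∕M⌋)`; `|∇^{η′*}_μ a′(x′) − ∇^{η*}_μ(blockMean a′)(⌊x′∕M⌋)| ≤ (d+1)(M−1)·θ₂(⌊x′∕M⌋ − e_μ)`. [folklore] -/
theorem fit_bdiffN_blockMean {M : ℕ} (hM : 0 < M) (μ : Fin d) {η η' : ℝ} (hMη : (M : ℝ) * η' = η) {a' : Site d → ℝ}
    {θ₂ : Site d → ℝ}
    (hstep : ∀ y, ∀ z ∈ slab M y μ, ∀ ν : Fin d,
      |fdiffN η' (fun w => w + Pi.single μ 1) a' (z + Pi.single ν 1) - fdiffN η' (fun w => w + Pi.single μ 1) a' z| ≤ θ₂ y)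
    (x' : Site d) :
    |bdiffN η' (Equiv.addRight (Pi.single μ (1 : ℤ))) a' x' -
        bdiffN η (Equiv.addRight (Pi.single μ (1 : ℤ))) (blockMean M a') (blockMap M x')|
      ≤ ((d : ℝ) + 1) * ((M : ℝ) - 1) * θ₂ (blockMap M x' - Pi.single μ 1) := by
  rw [bdiffN_eq_neg_fdiffN_pred, bdiffN_eq_neg_fdiffN_pred, ← neg_sub_neg, neg_neg, neg_neg, abs_sub_comm,
    fdiffN_blockMean hMη]
  set y₀ : Site d := blockMap M x' - Pi.single μ 1 with hy₀
  have hMz1 : (0 : ℤ) ≤ (M : ℤ) - 1 := by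
    have h1 : (1 : ℤ) ≤ M := by exact_mod_cast hM
    linarith
  refine abs_sub_windowMean_le hM μ y₀ (hstep y₀) hMz1 le_rfl fun i => ?_
  have h := coord_bounds_of_blockMap hM x' i
  simp only [hy₀, Pi.sub_apply]
  by_cases hi : i = μ
  · subst hi
    simp only [Pi.single_eq_same, if_true]
    constructor <;> nlinarith [h.1, h.2]
  · simp only [Pi.single_eq_of_ne hi, if_neg hi, add_zero, sub_zero]
    exact h

/-- RATE of species S2: with the (3.36)-SHAPED letter `θ₂ = η′G₂` and `Mη′ = η`, `(d+1)(M−1)θ₂ ≤ (d+1)·η·G₂`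
(`T4EtaRateCoeffDefect.coeff_osc_rate` at `d+1`). [folklore] -/
theorem species2_rate (d M : ℕ) {η η' G₂ : ℝ} (hη' : 0 ≤ η') (hG₂ : 0 ≤ G₂) (hMη : (M : ℝ) * η' = η) :
    ((d : ℝ) + 1) * ((M : ℝ) - 1) * (η' * G₂) ≤ ((d : ℝ) + 1) * η * G₂ := by
  have h := coeff_osc_rate (d + 1) M hη' hG₂ rfl hMη
  push_cast at h
  exact h

/-- RATE READING of species S2 ((R1) of the record): with `G₂ = C·ℓ^{−3}` — the (3.36) SHAPE, one power of `ℓ = L^jη` below the gradient bound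
`C·ℓ^{−2}` that is the SIZE of the coefficient `∇A` — the defect `(d+1)·η·G₂` is `(d+1) ×` (coefficient bound `Cℓ^{−2}`) `×` (rate factor `η∕ℓ`,
`γ = 1`). [folklore] -/
theorem rate_reading_deriv_coeff (n : ℕ) {η C ℓ : ℝ} (hℓ : ℓ ≠ 0) :
    ((n : ℝ) + 1) * η * (C * ℓ⁻¹ ^ 3) = (((n : ℝ) + 1) * (C * ℓ⁻¹ ^ 2)) * (η / ℓ) := by
  field_simp

end Species2

end Summit.QuantumFields.YangMills.BalabanUVNodes.N15.CoefficientSpecies
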